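import Summits.Ventures.CertifiedArithmetic.LowPrec.DoubleRoundingDecision
import Summits.Ventures.CertifiedArithmetic.LowPrec.DoubleRoundingVerdicts

/-!
# Theorem D-dr: the complete double-rounding matrix of the named formats

HONEST FRAMING (venture CertifiedArithmetic / cell `pub-lowprec`): certified error envelopes and
provably optimal rounding/accumulation schemes for low-precision formats under stated cost models;
every table by two implementations; no hardware or vendor claims.

`DRAdd X Y` (`DoubleRoundingDecision.lean`): "add two `X`-data in `Y`, convert to `X`" equals the
correctly rounded `X`-sum for ALL operand pairs (saturating RNE twice). THEOREM D-dr decides it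
for every ordered pair of the 13 named records (`namedFormats`: OCP MX e2m1 e3m2 e2m3 e4m3 e5m2,
IEEE P3109 binary8p3/p4/p5 and the finite-only binary8p3f = fnuz_e5m2, binary8p4f = fnuz_e4m3,
IEEE 754 binary16, bfloat16, binary32): `drAdd_named_iff` — `DRAdd X Y ↔ (X, Y) ∈ drAddPairs`,
a literal list of `60` pairs (`13` diagonal), and `drAdd_named_iff_test` — `↔ drAddTest X Y`, ONE
Boolean evaluation of the parameter records. With `P = P_X`, `q = P_Y`, `M = M_X` (largest
magnitude of `X` in quanta of `X`) the test reads: `F_X ⊆ F_Y` (`embedsTest`; necessary by the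
round trip with `b = 0`, `roundTrips_of_drAdd` + `RoundTripDecision.lean`) AND one of
* (S) `q = P` — same precision, wider range (`drAdd_of_manBits_eq`, 22 cells incl. the diagonal);
* (W) `q ≥ 2P + 1` — Figueroa's condition (`drAdd_of_wide` = the lean seat's
  `toRat_roundNE_roundNE_add`, 26 cells; the 2 cells binary8p3 / binary8p3f → binary16 with
  `bias_X = 16 > 15 = bias_Y` by the phantom wide format `Binary16W`);
* (T) `P < q ≤ 2P` and `M < drThreshold X Y`, the SATURATION-AWARE THRESHOLD `2^q₁ + 1` for
  `q₁ ≤ 2P - 1`, `2^(2P) + 2^(P+1)` for `q₁ = 2P`, `q₁ = max q (P + 2)`: the range of `X` is too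
  short to contain a failing pair (10 cells, all with an FP4/FP6 source, each by KERNEL EXHAUSTION
  of every operand pair: e2m1 through each FP6/FP8 format — `M = 12 < 24` —, e2m3 through binary8p5
  — `q = 5`, `60 < 65` — and through bfloat16 — `q = 8 = 2P`, `60 < 288`).
The other `7` embedded cells FAIL, each by ONE kernel-evaluated witness (`not_drAdd_of_ne` with the
theorem's minimal failing operands `drWitA`, `drWitB`: in quanta of `X`, `a = 2^q₁`,
`b = 2^(q₁-P) + 1` — `a + b ↦ a + b - 1` (the `X`-midpoint above `a`, even in `Y`) `↦ a` (even),
direct `a + 2^(q₁-P+1)` — resp. for `q₁ = 2P` `a = 2^(2P) + 2^(P+1)`, `b = -(2^P - 1)`: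
`2^(2P) + 2^P + 1 ↦ 2^(2P) + 2^P ↦ 2^(2P)`, direct `a`): e3m2 through e4m3 / binary8p4 / binary8p4f
(`q = P + 1`: `2 + 5/16 ↦ 9/4 ↦ 2`, direct `5/2`), e4m3 / binary8p4 / binary8p4f through bfloat16
(`q = 2P`: `9/16 - 15/512 ↦ 17/32 ↦ 1/2`, direct `9/16`, up to scaling) and binary8p5 through
bfloat16 (`2 + 9/128 ↦ 33/16 ↦ 2`, direct `17/8`); the `102` non-embedded cells fail with `b = 0`.

READINGS. binary32 is an innocuous intermediate for every narrower named format, binary16 for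
every format of at most 8 bits (binary8p5: `q = 11 = 2P + 1` exactly); bfloat16 is innocuous for
e2m1, e3m2, e2m3, e5m2, binary8p3, binary8p3f and NOT for e4m3, binary8p4, binary8p4f, binary8p5;
an FP8 intermediate of the SAME precision is innocuous for FP6 data (e2m3 via e4m3 / binary8p4 /
binary8p4f, e3m2 via e5m2 / binary8p3 / binary8p3f) while ONE MORE bit of precision is harmful
(e3m2 via e4m3); and the finite range rescues three cells the classical rule `q ≥ 2P + 1` misses
(e2m3 via binary8p5 and via bfloat16, e2m1 via everything).

STATUS OF CLAUSE (T) IN GENERAL (updated 2026-08-20): the threshold law is a KERNEL THEOREM FOR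
EVERY PAIR OF RECORDS, not only the named ones — innocuous side `drAdd_of_lt_threshold`
(`DoubleRoundingThreshold.lean`), failing side `not_drAdd_of_threshold_le` and the biconditional
`drAdd_iff_lt_threshold` (`DoubleRoundingThresholdWitness.lean`), assembled with (S) and (W) as
`drAdd_iff_test` / `drAdd_iff_clauses` (`DoubleRoundingWide.lean`: `embedsTest φ ψ → 1 ≤ φ.manBits
→ (DRAdd φ ψ ↔ drAddTest φ ψ)`); implementation A's integer-model theorem (exhaustively verified
for `P ≤ 7`, `DOUBLE-ROUNDING.md` §4) is its second implementation. In THIS file the law is used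
on the named pairs only (`drAddPairs_eq_filter`: the cell-by-cell matrix equals the test).
TWO IMPLEMENTATIONS: A = `code/enum/doubleround_decision.py` (test on all 225
name pairs; brute force over all operand pairs of the FP6/FP4 sources into all 15 formats, 45
cells / 122,445 pair evaluations, equal to the test; 147 witnesses replayed; byte-identical
`drAddPairs` literal); B = this file (kernel). No held FP8/P3109 operand table is enumerated:
FP8- and 16-bit-source cells are decided at parameter level or by one witness pair. PRIOR CELLS:
`DoubleRoundingVerdicts.lean` / `DoubleRoundingVerdictsP3109.lean` (lean seat) already hold 30 of
the 60 innocuous cells one by one (25 (W), 4 (T), 1 (S)) and witnesses for 5 of the 7 failing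
embedded cells, explicitly leaving binary8p3(f) → binary16 open (closed here via `Binary16W`); the
matrix subsumes them and adds 21 (S) cells, 6 (T) exhaustions, e2m1 → binary8p5, the two
phantom-wide cells, e3m2 → binary8p4(f) failing, and the uniform negative side.
-/

namespace Summit.Ventures.CertifiedArithmetic

open Literature.ComputerArithmetic.FloatingPoint
open Literature.ComputerArithmetic.FloatingPoint.Format
open Literature.ComputerArithmetic.FloatingPoint.MiniFloat

/-! ## §1 Witness replay and the threshold -/

/-- ONE failing pair of data refutes `DRAdd`; the data are named by rationals `x, y` through
`roundNE φ` (the identity on values of `φ`), so that a refutation is a single kernel evaluation. -/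
theorem not_drAdd_of_ne {φ ψ : Format} (x y : ℚ)
    (h : (roundNE φ (roundNE ψ ((roundNE φ x).toRat + (roundNE φ y).toRat)).toRat).toRat ≠
      (roundNE φ ((roundNE φ x).toRat + (roundNE φ y).toRat)).toRat) : ¬ DRAdd φ ψ :=
  fun hD => h (hD _ _)

/-- `q₁ = max (P_ψ) (P_φ + 2)` of Theorem D-dr, clause (T). -/
def drQ1 (φ ψ : Format) : ℕ := max (ψ.manBits + 1) (φ.manBits + 3)

/-- Theorem D-dr's SATURATION-AWARE THRESHOLD in quanta of `φ` (clause (T), `P_φ < P_ψ ≤ 2 P_φ`):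
`2^q₁ + 1` if `q₁ ≤ 2P_φ - 1`, else `2^(2P_φ) + 2^(P_φ+1)`; `DRAdd φ ψ` iff `maxScaled φ` is
below it. -/
def drThreshold (φ ψ : Format) : ℕ :=
  if drQ1 φ ψ ≤ 2 * φ.manBits + 1 then 2 ^ drQ1 φ ψ + 1
  else 2 ^ (2 * φ.manBits + 2) + 2 ^ (φ.manBits + 2)

/-- Witness operand `a`: `2^q₁` quanta of `φ` if `q₁ ≤ 2P_φ - 1`, else `2^(2P_φ) + 2^(P_φ+1)`. -/
def drWitA (φ ψ : Format) : ℚ :=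
  if drQ1 φ ψ ≤ 2 * φ.manBits + 1 then 2 ^ drQ1 φ ψ * φ.quantum
  else (2 ^ (2 * φ.manBits + 2) + 2 ^ (φ.manBits + 2)) * φ.quantum

/-- Witness operand `b`: `2^(q₁ - P_φ) + 1` quanta of `φ` if `q₁ ≤ 2P_φ - 1`,
else `-(2^P_φ - 1)`. -/
def drWitB (φ ψ : Format) : ℚ :=
  if drQ1 φ ψ ≤ 2 * φ.manBits + 1 then (2 ^ (drQ1 φ ψ - (φ.manBits + 1)) + 1) * φ.quantum
  else -((2 ^ (φ.manBits + 1) - 1) * φ.quantum)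

/-- THEOREM D-dr AS A BOOLEAN TEST on parameter records: `F_φ ⊆ F_ψ` and ((S) `m_φ = m_ψ` or
(W) `2 m_φ + 2 ≤ m_ψ` or (T) `maxScaled φ < drThreshold φ ψ`). Certified below on the named
pairs. -/
def drAddTest (φ ψ : Format) : Bool :=
  embedsTest φ ψ && (φ.manBits == ψ.manBits || decide (2 * φ.manBits + 2 ≤ ψ.manBits) ||
    decide (φ.maxScaled < drThreshold φ ψ))

/-! ## §2 Kernel exhaustion of the small-range cells (FP4 / FP6 sources only) -/

/-- A cell by exhaustion of all operand pairs. -/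
theorem drAdd_of_all {φ ψ : Format}
    (h : ((all φ).all fun a => (all φ).all fun b =>
      decide ((roundNE φ (roundNE ψ (a.toRat + b.toRat)).toRat).toRat
        = (roundNE φ (a.toRat + b.toRat)).toRat)) = true) : DRAdd φ ψ :=
  fun a b => of_decide_eq_true (forall₂_of_all_all (P := fun a b : MiniFloat φ =>
    decide ((roundNE φ (roundNE ψ (a.toRat + b.toRat)).toRat).toRat
      = (roundNE φ (a.toRat + b.toRat)).toRat)) h a b)

/-- e2m1 through e5m2: all `16²` pairs (`M = 12 < 24`). -/
theorem E2M1_add_via_E5M2 : DRAdd E2M1 E5M2 := drAdd_of_all (by decide +kernel)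

/-- e2m1 through binary8p3: all pairs. -/
theorem E2M1_add_via_Binary8p3 : DRAdd E2M1 Binary8p3 := drAdd_of_all (by decide +kernel)

/-- e2m1 through binary8p4: all pairs. -/
theorem E2M1_add_via_Binary8p4 : DRAdd E2M1 Binary8p4 := drAdd_of_all (by decide +kernel)

/-- e2m1 through binary8p3f: all pairs. -/
theorem E2M1_add_via_Binary8p3F : DRAdd E2M1 Binary8p3F := drAdd_of_all (by decide +kernel)

/-- e2m1 through binary8p4f (= fnuz_e4m3): all pairs. -/
theorem E2M1_add_via_Binary8p4F : DRAdd E2M1 Binary8p4F := drAdd_of_all (by decide +kernel)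

/-- One chunk of an operand-pair exhaustion: the first operands of sign `s` and exponent code `e`
(a separate kernel evaluation per chunk keeps every `decide +kernel` at `≤ 512` pairs; the
one-shot `64²` evaluation is at the edge of what every farm node reduces). -/
def drChunk (φ ψ : Format) (s : Bool) (e : ℕ) : Bool :=
  (all φ).all fun a => !(a.neg == s && a.expCode == e) ||
    (all φ).all fun b => decide ((roundNE φ (roundNE ψ (a.toRat + b.toRat)).toRat).toRat
      = (roundNE φ (a.toRat + b.toRat)).toRat)

/-- A cell by chunked exhaustion. -/
theorem drAdd_of_chunks {φ ψ : Format}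
    (h : ∀ s : Bool, ∀ e ≤ φ.emaxCode, drChunk φ ψ s e = true) : DRAdd φ ψ := by
  intro a b
  have h1 := List.all_eq_true.mp (h a.neg a.expCode a.expCode_le) a (mem_all a)
  simp only [beq_self_eq_true, Bool.and_self, Bool.not_true, Bool.false_or] at h1
  exact of_decide_eq_true (List.all_eq_true.mp h1 b (mem_all b))

/-- e2m3 through binary8p5, chunk `+`, exponent code 0. -/
theorem drChunk_E2M3_8p5_f0 : drChunk E2M3 Binary8p5 false 0 = true := by decide +kernel
/-- chunk `-`, 0. -/
theorem drChunk_E2M3_8p5_t0 : drChunk E2M3 Binary8p5 true 0 = true := by decide +kernel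
/-- chunk `+`, 1. -/
theorem drChunk_E2M3_8p5_f1 : drChunk E2M3 Binary8p5 false 1 = true := by decide +kernel
/-- chunk `-`, 1. -/
theorem drChunk_E2M3_8p5_t1 : drChunk E2M3 Binary8p5 true 1 = true := by decide +kernel
/-- chunk `+`, 2. -/
theorem drChunk_E2M3_8p5_f2 : drChunk E2M3 Binary8p5 false 2 = true := by decide +kernel
/-- chunk `-`, 2. -/
theorem drChunk_E2M3_8p5_t2 : drChunk E2M3 Binary8p5 true 2 = true := by decide +kernel
/-- chunk `+`, 3. -/
theorem drChunk_E2M3_8p5_f3 : drChunk E2M3 Binary8p5 false 3 = true := by decide +kernel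
/-- chunk `-`, 3. -/
theorem drChunk_E2M3_8p5_t3 : drChunk E2M3 Binary8p5 true 3 = true := by decide +kernel

/-- e2m3 through binary8p5: all `64²` pairs (`q = 5 < 2P + 1 = 9`, but `M = 60 < 65 = 2^6 + 1`: the
smallest failing pair `64 + 5` quanta is out of range), from the eight chunks. -/
theorem E2M3_add_via_Binary8p5 : DRAdd E2M3 Binary8p5 :=
  drAdd_of_chunks fun s e he => by
    have he3 : e ≤ 3 := he
    interval_cases e <;> cases s
    exacts [drChunk_E2M3_8p5_f0, drChunk_E2M3_8p5_t0, drChunk_E2M3_8p5_f1, drChunk_E2M3_8p5_t1,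
      drChunk_E2M3_8p5_f2, drChunk_E2M3_8p5_t2, drChunk_E2M3_8p5_f3, drChunk_E2M3_8p5_t3]

/-- The twelve named cells closed one at a time: the ten (T)-innocuous cells (kernel exhaustions
above and in `DoubleRoundingVerdicts.lean`) and the two phantom-wide cells
(`DoubleRoundingDecision.lean` §3). -/
def drXCells : List (Format × Format) := [
  (E2M1, E3M2), (E2M1, E2M3), (E2M1, E4M3), (E2M1, E5M2), (E2M1, Binary8p3), (E2M1, Binary8p4),
  (E2M1, Binary8p3F), (E2M1, Binary8p4F), (E2M3, Binary8p5), (E2M3, BFloat16),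
  (Binary8p3, Binary16), (Binary8p3F, Binary16)]

/-- Dispatcher for `drXCells` (membership is a cheap `decide`, so the matrix proof never unifies a
cell theorem against a foreign cell). -/
theorem drCellX {X Y : Format} (hm : (X, Y) ∈ drXCells) : DRAdd X Y := by
  simp only [drXCells, List.mem_cons, List.not_mem_nil, or_false, Prod.mk.injEq] at hm
  rcases hm with ⟨rfl, rfl⟩ | ⟨rfl, rfl⟩ | ⟨rfl, rfl⟩ | ⟨rfl, rfl⟩ | ⟨rfl, rfl⟩ | ⟨rfl, rfl⟩ |
    ⟨rfl, rfl⟩ | ⟨rfl, rfl⟩ | ⟨rfl, rfl⟩ | ⟨rfl, rfl⟩ | ⟨rfl, rfl⟩ | ⟨rfl, rfl⟩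
  exacts [E2M1_add_via_E3M2_all, E2M1_add_via_E2M3_all, E2M1_add_via_E4M3_all,
    E2M1_add_via_E5M2, E2M1_add_via_Binary8p3, E2M1_add_via_Binary8p4, E2M1_add_via_Binary8p3F,
    E2M1_add_via_Binary8p4F, E2M3_add_via_Binary8p5, E2M3_add_via_BFloat16,
    Binary8p3_add_via_Binary16, Binary8p3F_add_via_Binary16]

/-! ## §3 The matrix -/

/-- THE MATRIX (Theorem D-dr on the named records): the `60` ordered pairs `(X, Y)` with
`DRAdd X Y`, in the order of `namedFormats`; byte-identical to implementation A's output
`certs/enum/DOUBLE-ROUNDING-lean-literals.txt`. -/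
def drAddPairs : List (Format × Format) := [
  (E2M1, E2M1), (E2M1, E3M2), (E2M1, E2M3), (E2M1, E4M3), (E2M1, E5M2), (E2M1, Binary8p3),
  (E2M1, Binary8p4), (E2M1, Binary8p5), (E2M1, Binary8p3F), (E2M1, Binary8p4F), (E2M1, Binary16),
  (E2M1, BFloat16), (E2M1, Binary32), (E3M2, E3M2), (E3M2, E5M2), (E3M2, Binary8p3),
  (E3M2, Binary8p3F), (E3M2, Binary16), (E3M2, BFloat16), (E3M2, Binary32), (E2M3, E2M3),
  (E2M3, E4M3), (E2M3, Binary8p4), (E2M3, Binary8p5), (E2M3, Binary8p4F), (E2M3, Binary16),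
  (E2M3, BFloat16), (E2M3, Binary32), (E4M3, E4M3), (E4M3, Binary16), (E4M3, Binary32),
  (E5M2, E5M2), (E5M2, Binary8p3F), (E5M2, Binary16), (E5M2, BFloat16), (E5M2, Binary32),
  (Binary8p3, Binary8p3), (Binary8p3, Binary8p3F), (Binary8p3, Binary16), (Binary8p3, BFloat16),
  (Binary8p3, Binary32), (Binary8p4, Binary8p4), (Binary8p4, Binary8p4F), (Binary8p4, Binary16),
  (Binary8p4, Binary32), (Binary8p5, Binary8p5), (Binary8p5, Binary16), (Binary8p5, Binary32),
  (Binary8p3F, Binary8p3F), (Binary8p3F, Binary16), (Binary8p3F, BFloat16), (Binary8p3F, Binary32),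
  (Binary8p4F, Binary8p4F), (Binary8p4F, Binary16), (Binary8p4F, Binary32), (Binary16, Binary16),
  (Binary16, Binary32), (BFloat16, BFloat16), (BFloat16, Binary32), (Binary32, Binary32)]

/-- `60` cells, `47` off the diagonal. -/
theorem drAddPairs_length :
    drAddPairs.length = 60 ∧ (drAddPairs.filter fun p => decide (p.1 ≠ p.2)).length = 47 := by
  decide

/-- Innocuous double rounding needs the embedding: the matrix is a sub-lattice of `embedPairs`. -/
theorem drAddPairs_sub_embedPairs : ∀ p ∈ drAddPairs, p ∈ embedPairs := by decide

/-- The matrix IS the test of §1 on the named pairs (implementation B of the threshold law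
there). -/
theorem drAddPairs_eq_filter : drAddPairs = namedPairs.filter (fun p => drAddTest p.1 p.2) := by
  decide

/-- Cell form: a non-embedded named pair (embedding test `false`; round trip = embedding on the
named pairs, `RoundTripDecision.lean`). -/
theorem drCellN {X Y : Format} (hX : X ∈ namedFormats) (hY : Y ∈ namedFormats)
    (he : embedsTest X Y = false) (hm : (X, Y) ∉ drAddPairs) :
    DRAdd X Y ↔ (X, Y) ∈ drAddPairs :=
  iff_of_false (fun h => not_embeds_of_test (stdOperand_of_mem_namedFormats X hX) he
    ((roundTrips_named_iff_embeds hX hY).mp (roundTrips_of_drAdd h))) hm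

/-- Cell form: an innocuous pair. -/
theorem drCellT {X Y : Format} (h : DRAdd X Y) (hm : (X, Y) ∈ drAddPairs) :
    DRAdd X Y ↔ (X, Y) ∈ drAddPairs := iff_of_true h hm

/-- Cell form: a failing embedded pair, by the witness `(drWitA X Y, drWitB X Y)`. -/
theorem drCellW {X Y : Format}
    (h : (roundNE X (roundNE Y ((roundNE X (drWitA X Y)).toRat
        + (roundNE X (drWitB X Y)).toRat)).toRat).toRat
      ≠ (roundNE X ((roundNE X (drWitA X Y)).toRat + (roundNE X (drWitB X Y)).toRat)).toRat)
    (hm : (X, Y) ∉ drAddPairs) : DRAdd X Y ↔ (X, Y) ∈ drAddPairs :=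
  iff_of_false (not_drAdd_of_ne _ _ h) hm

set_option maxHeartbeats 8000000 in
/-- THEOREM D-dr (the named formats): for named `X`, `Y`, double rounding of `X`-sums through `Y`
is innocuous iff `(X, Y)` is one of the `60` pairs of `drAddPairs`. Each of the `169` cells is
closed by the engine its class names: non-embedding (embedding test `false`), (S), (W), the
twelve `drXCells` (ten exhaustions, two phantom-wide), or one witness. -/
theorem drAdd_named_iff {X Y : Format} (hX : X ∈ namedFormats) (hY : Y ∈ namedFormats) :
    DRAdd X Y ↔ (X, Y) ∈ drAddPairs := by
  simp only [namedFormats, List.mem_cons, List.not_mem_nil, or_false] at hX hY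
  rcases hX with rfl | rfl | rfl | rfl | rfl | rfl | rfl | rfl | rfl | rfl | rfl | rfl | rfl <;>
  rcases hY with rfl | rfl | rfl | rfl | rfl | rfl | rfl | rfl | rfl | rfl | rfl | rfl | rfl
  all_goals first
    | exact drCellN (by decide) (by decide) (by decide) (by decide +kernel)
    | exact drCellT (drAdd_of_manBits_eq rfl (by decide) (by decide) (by decide +kernel))
        (by decide +kernel)
    | exact drCellT (drAdd_of_wide (by decide) (by decide) (by decide +kernel)) (by decide +kernel)
    | exact drCellT (drCellX (by decide +kernel)) (by decide +kernel)
    | exact drCellW (by decide +kernel) (by decide +kernel)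

/-- THEOREM D-dr AS ONE BOOLEAN EVALUATION: for named `X`, `Y`, `DRAdd X Y ↔ drAddTest X Y`. -/
theorem drAdd_named_iff_test {X Y : Format} (hX : X ∈ namedFormats) (hY : Y ∈ namedFormats) :
    DRAdd X Y ↔ drAddTest X Y = true := by
  rw [drAdd_named_iff hX hY, drAddPairs_eq_filter, List.mem_filter]
  exact ⟨fun h => h.2, fun h => ⟨mem_namedPairs hX hY, h⟩⟩

/-- Corollary: innocuous double rounding of named formats needs `F_X ⊆ F_Y`. -/
theorem embeds_of_drAdd_named {X Y : Format} (hX : X ∈ namedFormats) (hY : Y ∈ namedFormats)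
    (h : DRAdd X Y) : Embeds X Y :=
  (embeds_named_iff hX hY).mpr (drAddPairs_sub_embedPairs _ ((drAdd_named_iff hX hY).mp h))

/-! ## §4 Readings (kernel instances) -/

/-- bfloat16 as intermediate: fine for e5m2 and binary8p3, NOT for e4m3, binary8p4f, binary8p5. -/
example : DRAdd E5M2 BFloat16 ∧ DRAdd Binary8p3 BFloat16 ∧ ¬ DRAdd E4M3 BFloat16 ∧
    ¬ DRAdd Binary8p4F BFloat16 ∧ ¬ DRAdd Binary8p5 BFloat16 :=
  ⟨(drAdd_named_iff (by decide) (by decide)).mpr (by decide +kernel),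
   (drAdd_named_iff (by decide) (by decide)).mpr (by decide +kernel),
   fun h => absurd ((drAdd_named_iff (by decide) (by decide)).mp h) (by decide +kernel),
   fun h => absurd ((drAdd_named_iff (by decide) (by decide)).mp h) (by decide +kernel),
   fun h => absurd ((drAdd_named_iff (by decide) (by decide)).mp h) (by decide +kernel)⟩

/-- Same precision is innocuous, one more bit is not: e2m3 via e4m3 and e3m2 via e5m2 hold,
e3m2 via e4m3 fails; binary8p4 via binary8p4f (= fnuz_e4m3) holds. -/
example : DRAdd E2M3 E4M3 ∧ DRAdd E3M2 E5M2 ∧ ¬ DRAdd E3M2 E4M3 ∧ DRAdd Binary8p4 Binary8p4F :=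
  ⟨drAdd_of_manBits_eq rfl (by decide) (by decide) (by decide +kernel),
   drAdd_of_manBits_eq rfl (by decide) (by decide) (by decide +kernel),
   not_drAdd_of_ne (drWitA E3M2 E4M3) (drWitB E3M2 E4M3) (by decide +kernel),
   drAdd_of_manBits_eq rfl (by decide) (by decide) (by decide +kernel)⟩

/-- The bias exception and the finite-range exception: binary8p3 via binary16 (bias `16 > 15`) and
e2m3 via binary8p5 (`q = 5 < 9`) are innocuous; bfloat16 via binary16 is not even a round trip. -/
example : DRAdd Binary8p3 Binary16 ∧ DRAdd E2M3 Binary8p5 ∧ ¬ DRAdd BFloat16 Binary16 :=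
  ⟨Binary8p3_add_via_Binary16, E2M3_add_via_Binary8p5,
   not_drAdd_of_not_roundTrips (not_roundTrips_of_test (by decide) (by decide) (by decide +kernel))⟩

end Summit.Ventures.CertifiedArithmetic
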